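import Mathlib
import Literature.NumberTheory.NumberFields.TraceFormTotallyReal
import Literature.NumberTheory.NumberFields.SmallNormReduction

/-!
# The abstract trace-zero parabola lift (registered stub `traceZeroLift` of the crux
`LevelOneGL2Designs`, stmt-MatrixMultiplication-14080; wall-breaker axis k8/12
"parabola lifts over finite fields")

Pohoata's Proposition 5.1 (arXiv:2607.20422, 2026) for an ARBITRARY totally real number field
`K`, stated over the ring of integers and a surjection `φ : 𝓞 K → ℤ/p` (the reduction modulo a
degree-one prime).  To a parameter `(x, a) ∈ X × A ⊆ 𝓞 K × 𝓞 K` attach the flag of `AG(2,p)`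

  point `(φ(x² + a), φ x)`,  line `{(u,v) : u - 2·φ(x)·v = φ(a - x²)}`

(the point `(x²+a, x)` of the parabola `u = v² + a` together with its tangent there, reduced
modulo `p`).  The polynomial identity

  `(x² + a) - 2·x·x' - (a' - x'²) = (x' - x)² - (a' - a)`

shows that the point of `(x,a)` lies on the line of `(x',a')` iff `φ((x'-x)² - (a'-a)) = 0`.
If `A` consists of trace-zero elements (so that `A - A` contains no non-zero square, the trace
form of a totally real field being positive definite —
`Literature.NumberTheory.NumberFields.sqDiffFree_of_trace_eq_zero`) and all the relevant
differences have `|N_{K/ℚ}| < p` (so that reduction modulo `ker φ`, an ideal of norm `p`, creates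
no new zeros — `Literature.NumberTheory.NumberFields.eq_zero_of_map_eq_zero_of_natAbs_norm_lt`),
then off-diagonal incidences are impossible, the `|X|·|A|` flags are pairwise distinct, and after
discarding the `≤ p` flags whose line passes through the origin (those with `φ a = φ(x)²`, at
most one `a` per residue `φ x`) and normalising the remaining lines to `⟨w, ℓ⟩ = 1` we obtain a
strong representative system in the format of `stub_tangencySets` with `|X|·|A| ≤ |S| + p`.

This is the common engine behind every number-field parabola lift in the tree (cyclotomic,
multiquadratic, quadratic orders were each done in explicit coordinates); here it is proved once,
abstractly, exactly as registered (`ledger` stub `traceZeroLift` of stmt-MatrixMultiplication-14080).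

References: C. Pohoata, *The sharp exponent for the minimal distance problem*, arXiv:2607.20422
(2026), Proposition 5.1 [bib: Pohoata2026SharpExponentMinimalDistance]; Z. Hunter, C. Pohoata,
J. Verstraëte, S. Zhang, arXiv:2601.19879 (2026), Prop. 2.3 (the case `K = ℚ`)
[bib: HunterPohoataVerstraeteZhang2026].
-/

-- justification: the summit/problem path `MatrixMultiplication.MatrixMultiplication` is fixed by the
-- tree layout (D-0017), so the namespace necessarily repeats a component.
set_option linter.dupNamespace false

noncomputable section

open NumberField Matrix

namespace Summit.MatrixMultiplication.MatrixMultiplication.Theorems.LevelOneGL2Designs.TraceZeroLift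

open Literature.NumberTheory.NumberFields

/-- **Abstract trace-zero parabola lift** (Pohoata 2026, Prop. 5.1, for any totally real `K`).
Let `φ : 𝓞 K → ZMod p` be a surjective ring map, `X, A ⊆ 𝓞 K` finite with every `a ∈ A` of trace
zero, and suppose that for all `x, x' ∈ X`, `a, a' ∈ A` the three algebraic integers
`(x'-x)² - (a-a')`, `x'-x`, `a-a'` have `|N_{K/ℚ}| < p`.  Then the reduced parabola flags
`(x,a) ↦ (point (φ(x²+a), φ x), line u - 2φ(x)v = φ(a-x²))`, with the `≤ p` flags whose line
passes through the origin removed, form a strong representative system of `AG(2,p)` in the format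
of `stub_tangencySets`: `S ⊆ 𝔽_p² × 𝔽_p²` with `⟨f.1, f'.2⟩ = 1 ↔ f = f'`, and `|X|·|A| ≤ |S| + p`.
[cite: Pohoata2026SharpExponentMinimalDistance, Proposition 5.1] -/
theorem traceZeroLift {K : Type*} [Field K] [NumberField K] [IsTotallyReal K] {p : ℕ}
    [Fact p.Prime] (φ : 𝓞 K →+* ZMod p) (hφ : Function.Surjective φ) (X A : Finset (𝓞 K))
    (hA : ∀ a ∈ A, Algebra.trace ℚ K (a : K) = 0)
    (hN : ∀ x ∈ X, ∀ x' ∈ X, ∀ a ∈ A, ∀ a' ∈ A,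
      (Algebra.norm ℤ ((x' - x) ^ 2 - (a - a'))).natAbs < p ∧
      (Algebra.norm ℤ (x' - x)).natAbs < p ∧ (Algebra.norm ℤ (a - a')).natAbs < p) :
    ∃ S : Finset ((Fin 2 → ZMod p) × (Fin 2 → ZMod p)),
      X.card * A.card ≤ S.card + p ∧ ∀ f ∈ S, ∀ f' ∈ S, (dotProduct f.1 f'.2 = 1 ↔ f = f') := by
  classical
  -- degenerate case: one of the two parameter sets is empty
  by_cases hXA : X.Nonempty ∧ A.Nonempty
  swap
  · refine ⟨∅, ?_, by simp⟩
    have h0 : X.card * A.card = 0 := by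
      rw [not_and_or, Finset.not_nonempty_iff_eq_empty, Finset.not_nonempty_iff_eq_empty] at hXA
      rcases hXA with h | h <;> simp [h]
    simp [h0]
  obtain ⟨⟨x₀, hx₀⟩, ⟨a₀, ha₀⟩⟩ := hXA
  -- `φ` is injective on `X` and on `A` (no wrap-around for the small-norm differences)
  have hXinj : ∀ x ∈ X, ∀ x' ∈ X, φ x = φ x' → x = x' := by
    intro x hx x' hx' h
    have hlt := (hN x hx x' hx' a₀ ha₀ a₀ ha₀).2.1
    have h0 : φ (x' - x) = 0 := by rw [map_sub, h, sub_self]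
    have := eq_zero_of_map_eq_zero_of_natAbs_norm_lt φ hφ h0 hlt
    exact (sub_eq_zero.mp this).symm
  have hAinj : ∀ a ∈ A, ∀ a' ∈ A, φ a = φ a' → a = a' := by
    intro a ha a' ha' h
    have hlt := (hN x₀ hx₀ x₀ hx₀ a ha a' ha').2.2
    have h0 : φ (a - a') = 0 := by rw [map_sub, h, sub_self]
    exact sub_eq_zero.mp (eq_zero_of_map_eq_zero_of_natAbs_norm_lt φ hφ h0 hlt)
  -- the key step: a reduced incidence is a genuine incidence, hence diagonal (trace positivity)
  have hkey : ∀ x ∈ X, ∀ x' ∈ X, ∀ a ∈ A, ∀ a' ∈ A,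
      φ ((x' - x) ^ 2 - (a' - a)) = 0 → x = x' ∧ a = a' := by
    intro x hx x' hx' a ha a' ha' h
    have hlt := (hN x hx x' hx' a' ha' a ha).1
    have hz : (x' - x) ^ 2 - (a' - a) = 0 := eq_zero_of_map_eq_zero_of_natAbs_norm_lt φ hφ h hlt
    have hz' : ((a' : K)) - (a : K) = ((x' : K) - (x : K)) ^ 2 := by
      have := congrArg (algebraMap (𝓞 K) K) (sub_eq_zero.mp hz)
      simp only [map_pow, map_sub] at this
      exact this.symm
    have hxx : (x' : K) - (x : K) = 0 :=
      sqDiffFree_of_trace_eq_zero (A := ((↑) : 𝓞 K → K) '' (A : Set (𝓞 K)))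
        (by rintro _ ⟨b, hb, rfl⟩; exact hA b hb) ⟨a', ha', rfl⟩ ⟨a, ha, rfl⟩ hz'
    have hx_eq : x = x' := (RingOfIntegers.ext (sub_eq_zero.mp hxx)).symm
    refine ⟨hx_eq, ?_⟩
    subst hx_eq
    have : a' - a = 0 := by
      rw [sub_self, sq, zero_mul, zero_sub, neg_eq_zero] at hz
      exact hz
    exact (sub_eq_zero.mp this).symm
  -- the flag map and the parameter sets
  set F : 𝓞 K × 𝓞 K → (Fin 2 → ZMod p) × (Fin 2 → ZMod p) := fun t =>
    (![φ (t.1 ^ 2 + t.2), φ t.1], (φ (t.2 - t.1 ^ 2))⁻¹ • ![1, -2 * φ t.1]) with hF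
  set T := (X ×ˢ A).filter (fun t => φ (t.2 - t.1 ^ 2) ≠ 0) with hT
  set B := (X ×ˢ A).filter (fun t => ¬ φ (t.2 - t.1 ^ 2) ≠ 0) with hB
  have hmemT : ∀ t ∈ T, t.1 ∈ X ∧ t.2 ∈ A ∧ φ (t.2 - t.1 ^ 2) ≠ 0 := by
    intro t ht
    simp only [hT, Finset.mem_filter, Finset.mem_product] at ht
    exact ⟨ht.1.1, ht.1.2, ht.2⟩
  -- `F` is injective on `T`
  have hFinj : Set.InjOn F T := by
    intro t ht t' ht' h
    obtain ⟨htx, hta, -⟩ := hmemT t ht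
    obtain ⟨htx', hta', -⟩ := hmemT t' ht'
    have h1 : (F t).1 1 = (F t').1 1 := by rw [h]
    have h0 : (F t).1 0 = (F t').1 0 := by rw [h]
    simp only [hF, Matrix.cons_val_one, Matrix.cons_val_zero] at h1 h0
    have hx : t.1 = t'.1 := hXinj _ htx _ htx' h1
    rw [map_add, map_add, hx, add_right_inj] at h0
    exact Prod.ext hx (hAinj _ hta _ hta' h0)
  -- the flags with a line through the origin inject into `ZMod p` via `φ ∘ Prod.fst`
  have hBinj : Set.InjOn (fun t : 𝓞 K × 𝓞 K => φ t.1) B := by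
    intro t ht t' ht' h
    simp only [hB, Finset.coe_filter, Finset.mem_product, not_not, Set.mem_setOf_eq] at ht ht'
    have hx : t.1 = t'.1 := hXinj _ ht.1.1 _ ht'.1.1 h
    have h2 : φ t.2 = φ (t.1 ^ 2) := sub_eq_zero.mp (by rw [← map_sub]; exact ht.2)
    have h2' : φ t'.2 = φ (t'.1 ^ 2) := sub_eq_zero.mp (by rw [← map_sub]; exact ht'.2)
    have ha : t.2 = t'.2 := hAinj _ ht.1.2 _ ht'.1.2 (by rw [h2, h2', hx])
    exact Prod.ext hx ha
  have hBcard : B.card ≤ p := by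
    have := Finset.card_le_card_of_injOn (fun t : 𝓞 K × 𝓞 K => φ t.1) (fun t _ => Finset.mem_univ _) hBinj
    simpa [ZMod.card] using this
  -- the dot product of a point with a (normalised) line
  have hdot : ∀ t t' : 𝓞 K × 𝓞 K, dotProduct (F t).1 (F t').2 =
      (φ (t'.2 - t'.1 ^ 2))⁻¹ * (φ (t.1 ^ 2 + t.2) - 2 * φ t.1 * φ t'.1) := by
    intro t t'
    simp only [hF, dotProduct, Fin.sum_univ_two, Matrix.cons_val_zero, Matrix.cons_val_one,
      Pi.smul_apply, smul_eq_mul]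
    ring
  have hid : ∀ t t' : 𝓞 K × 𝓞 K, φ (t.1 ^ 2 + t.2) - 2 * φ t.1 * φ t'.1 - φ (t'.2 - t'.1 ^ 2) =
      φ ((t'.1 - t.1) ^ 2 - (t'.2 - t.2)) := by
    intro t t'
    simp only [map_sub, map_add, map_pow]
    ring
  refine ⟨T.image F, ?_, ?_⟩
  · -- counting: |X|·|A| = |T| + |B| ≤ |S| + p
    have hsplit : T.card + B.card = X.card * A.card := by
      rw [hT, hB, Finset.card_filter_add_card_filter_not, Finset.card_product]
    rw [Finset.card_image_of_injOn hFinj]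
    omega
  · intro f hf f' hf'
    simp only [Finset.mem_image] at hf hf'
    obtain ⟨t, ht, rfl⟩ := hf
    obtain ⟨t', ht', rfl⟩ := hf'
    obtain ⟨htx, hta, hκ⟩ := hmemT t ht
    obtain ⟨htx', hta', hκ'⟩ := hmemT t' ht'
    rw [hdot, inv_mul_eq_one₀ hκ']
    constructor
    · intro h
      have h0 : φ ((t'.1 - t.1) ^ 2 - (t'.2 - t.2)) = 0 := by
        rw [← hid, ← h, sub_self]
      obtain ⟨hx, ha⟩ := hkey _ htx _ htx' _ hta _ hta' h0
      rw [Prod.ext hx ha]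
    · intro h
      have htt : t = t' := hFinj ht ht' h
      subst htt
      simp only [map_sub, map_add, map_pow]
      ring
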